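import Mathlib.Analysis.SpecialFunctions.Pow.Deriv
import Mathlib.Analysis.InnerProductSpace.NormPow
import Mathlib.Analysis.Calculus.FDeriv.Prod
import Mathlib.Analysis.Calculus.Deriv.Prod
import Mathlib.Topology.MetricSpace.Bounded
import HarnessLib

/-!
# The free oscillator `Ĥ(P,Q) = P²/2 + |Q|^{2k}/2k`: scalings (Hairer–Mattingly 2009, §3.1)

Trunk T-KINETIC (`Literature/MathematicalPhysics/KineticTheory`). First brick of the formalisation
of [HM09, Thm 5.6] (the Lyapunov function of the three-oscillator chain with strong pinning):
the "free" oscillator of [HM09, §3.1, display (e:defHhat)],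

  `Ĥ(P, Q) = P²/2 + |Q|^{2k}/(2k)`,   `X_Ĥ = P ∂_Q - Q|Q|^{2k-2} ∂_P`   (`k > 1` real),

its anisotropic dilations `dil λ (P, Q) = (λP, λ^{1/k}Q)` (`Ĥ ∘ dil λ = λ² Ĥ`), the notion
"`ψ` SCALES LIKE `Ĥ^α`" of [HM09, Def. 3.4] (`ψ(λP, λ^{1/k}Q) = λ^{2α} ψ(P,Q)`), the radial
projection `proj` onto the unit shell `{Ĥ = 1}` (compact, misses `0`), and [HM09, Lemma 3.5]:
if `ψ ∈ C¹(ℝ² ∖ 0)` scales like `Ĥ^α` then `∂_P ψ`, `∂_Q ψ`, `X_Ĥ ψ` scale like `Ĥ^{α-1/2}`,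
`Ĥ^{α-1/(2k)}`, `Ĥ^{α+1/2-1/(2k)}`; plus the sup bound `|ψ| ≤ C Ĥ^α` for `ψ` continuous on the
unit shell. Everything is proved; no named facts. Coordinates: `z : ℝ × ℝ`, `z.1 = P`, `z.2 = Q`.

## References

* M. Hairer, J. C. Mattingly, *Slow energy dissipation in anharmonic oscillator chains*,
  Comm. Pure Appl. Math. **62** (2009) 999–1032, arXiv:0712.3884, §3.1 (Def. 3.4, Lemma 3.5).
  [cite: HairerMattingly2009, §3.1]
-/

noncomputable section

open Set Filter Topology Metric

namespace Literature.MathematicalPhysics.KineticTheory.FreeOscillator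

variable {k : ℝ}

/-! ### The Hamiltonian `Ĥ` -/

/-- The free-oscillator energy `Ĥ(P,Q) = P²/2 + |Q|^{2k}/(2k)`. [cite: HairerMattingly2009, §3.1 (e:defHhat)] -/
def hHat (k : ℝ) (z : ℝ × ℝ) : ℝ := z.1 ^ 2 / 2 + |z.2| ^ (2 * k) / (2 * k)

/-- Unfolding lemma for `hHat`. [folklore] -/
theorem hHat_apply (k : ℝ) (z : ℝ × ℝ) : hHat k z = z.1 ^ 2 / 2 + |z.2| ^ (2 * k) / (2 * k) := rfl

/-- `Ĥ ≥ 0`. [folklore] -/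
theorem hHat_nonneg (hk : 0 < k) (z : ℝ × ℝ) : 0 ≤ hHat k z := by
  unfold hHat; positivity

/-- `P² ≤ 2Ĥ`. [folklore] -/
theorem sq_le_two_mul_hHat (hk : 0 < k) (z : ℝ × ℝ) : z.1 ^ 2 ≤ 2 * hHat k z := by
  unfold hHat
  have : 0 ≤ |z.2| ^ (2 * k) / (2 * k) := by positivity
  linarith

/-- `|Q|^{2k} ≤ 2k Ĥ`. [folklore] -/
theorem abs_rpow_le_two_mul_k_mul_hHat (hk : 0 < k) (z : ℝ × ℝ) :
    |z.2| ^ (2 * k) ≤ 2 * k * hHat k z := by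
  unfold hHat
  have h1 : 0 ≤ z.1 ^ 2 / 2 := by positivity
  have h2 : 2 * k * (|z.2| ^ (2 * k) / (2 * k)) = |z.2| ^ (2 * k) := by
    field_simp
  nlinarith [h1, h2, hk]

/-- `Ĥ(0) = 0`. [folklore] -/
theorem hHat_zero (hk : 0 < k) : hHat k 0 = 0 := by
  simp [hHat, Real.zero_rpow (by positivity : (2 * k) ≠ 0)]

/-- `Ĥ z = 0 ↔ z = 0`. [folklore] -/
theorem hHat_eq_zero_iff (hk : 0 < k) {z : ℝ × ℝ} : hHat k z = 0 ↔ z = 0 := by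
  refine ⟨fun h => ?_, fun h => h ▸ hHat_zero hk⟩
  have h1 := sq_le_two_mul_hHat hk z
  have h2 := abs_rpow_le_two_mul_k_mul_hHat hk z
  rw [h, mul_zero] at h1
  rw [h, mul_zero] at h2
  have hP : z.1 = 0 := by nlinarith [sq_nonneg z.1]
  have hQ' : |z.2| ^ (2 * k) = 0 := le_antisymm h2 (Real.rpow_nonneg (abs_nonneg _) _)
  have hQ : z.2 = 0 := by
    rcases (Real.rpow_eq_zero (abs_nonneg z.2) (by positivity)).1 hQ' with h
    exact abs_eq_zero.1 h
  exact Prod.ext hP hQ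

/-- `Ĥ z > 0` for `z ≠ 0`. [folklore] -/
theorem hHat_pos (hk : 0 < k) {z : ℝ × ℝ} (hz : z ≠ 0) : 0 < hHat k z :=
  lt_of_le_of_ne (hHat_nonneg hk z) fun h => hz ((hHat_eq_zero_iff hk).1 h.symm)

/-- `Ĥ` is continuous. [folklore] -/
theorem continuous_hHat (hk : 0 < k) : Continuous (hHat k) := by
  unfold hHat
  refine Continuous.add (by fun_prop) (Continuous.div_const ?_ _)
  exact (continuous_abs.comp continuous_snd).rpow_const fun _ => Or.inr (by positivity)

/-- Bounds on the coordinates in terms of the energy: `|P| ≤ √(2Ĥ)` in the form `P² ≤ 2Ĥ`, and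
`|Q| ≤ (2kĤ)^{1/(2k)}`. [folklore] -/
theorem abs_snd_le_rpow_hHat (hk : 0 < k) (z : ℝ × ℝ) :
    |z.2| ≤ (2 * k * hHat k z) ^ (1 / (2 * k)) := by
  have h := abs_rpow_le_two_mul_k_mul_hHat hk z
  have h2 : |z.2| = (|z.2| ^ (2 * k)) ^ (1 / (2 * k)) := by
    rw [← Real.rpow_mul (abs_nonneg _), mul_one_div_cancel (by positivity), Real.rpow_one]
  rw [h2]
  exact Real.rpow_le_rpow (Real.rpow_nonneg (abs_nonneg _) _) h (by positivity)

/-! ### The unit shell `{Ĥ = 1}` -/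

/-- The unit energy shell `S₁ = {Ĥ = 1}`. [cite: HairerMattingly2009, §3.1] -/
def unitShell (k : ℝ) : Set (ℝ × ℝ) := {z | hHat k z = 1}

/-- Membership in the unit shell. [folklore] -/
theorem mem_unitShell {z : ℝ × ℝ} : z ∈ unitShell k ↔ hHat k z = 1 := Iff.rfl

/-- The origin is not on the unit shell. [folklore] -/
theorem zero_not_mem_unitShell (hk : 0 < k) : (0 : ℝ × ℝ) ∉ unitShell k := by
  rw [mem_unitShell, hHat_zero hk]; norm_num

/-- Points of the unit shell are nonzero. [folklore] -/
theorem ne_zero_of_mem_unitShell (hk : 0 < k) {z : ℝ × ℝ} (hz : z ∈ unitShell k) : z ≠ 0 :=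
  fun h => zero_not_mem_unitShell hk (h ▸ hz)

/-- The unit shell is closed. [folklore] -/
theorem isClosed_unitShell (hk : 0 < k) : IsClosed (unitShell k) :=
  isClosed_eq (continuous_hHat hk) continuous_const

/-- A norm bound on energy sublevel sets: `Ĥ z ≤ E ⇒ ‖z‖ ≤ max √(2E) (2kE)^{1/2k}`. [folklore] -/
theorem norm_le_of_hHat_le (hk : 0 < k) {z : ℝ × ℝ} {E : ℝ} (hz : hHat k z ≤ E) :
    ‖z‖ ≤ max (Real.sqrt (2 * E)) ((2 * k * E) ^ (1 / (2 * k))) := by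
  rw [Prod.norm_def]
  refine max_le_max ?_ ?_
  · rw [Real.norm_eq_abs, ← Real.sqrt_sq_eq_abs]
    exact Real.sqrt_le_sqrt (by linarith [sq_le_two_mul_hHat hk z])
  · rw [Real.norm_eq_abs]
    refine (abs_snd_le_rpow_hHat hk z).trans ?_
    have h0 : 0 ≤ 2 * k * hHat k z := by have := hHat_nonneg hk z; positivity
    exact Real.rpow_le_rpow h0 (by nlinarith) (by positivity)

/-- Energy sublevel sets are bounded. [folklore] -/
theorem isBounded_setOf_hHat_le (hk : 0 < k) (E : ℝ) : Bornology.IsBounded {z : ℝ × ℝ | hHat k z ≤ E} :=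
  isBounded_iff_forall_norm_le.2 ⟨_, fun _ hz => norm_le_of_hHat_le hk hz⟩

/-- Energy sublevel sets are compact (`Ĥ` is coercive). [folklore] -/
theorem isCompact_setOf_hHat_le (hk : 0 < k) (E : ℝ) : IsCompact {z : ℝ × ℝ | hHat k z ≤ E} :=
  Metric.isCompact_of_isClosed_isBounded (isClosed_le (continuous_hHat hk) continuous_const)
    (isBounded_setOf_hHat_le hk E)

/-- The unit shell is compact. [folklore] -/
theorem isCompact_unitShell (hk : 0 < k) : IsCompact (unitShell k) :=
  (isCompact_setOf_hHat_le hk 1).of_isClosed_subset (isClosed_unitShell hk)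
    fun _ hz => le_of_eq hz

/-- A base point of the unit shell: `(√2, 0)`. [folklore] -/
theorem sqrt_two_zero_mem_unitShell (hk : 0 < k) : ((Real.sqrt 2, 0) : ℝ × ℝ) ∈ unitShell k := by
  rw [mem_unitShell, hHat_apply, Real.sq_sqrt (by norm_num : (0:ℝ) ≤ 2), abs_zero,
    Real.zero_rpow (by positivity)]
  simp

/-! ### Dilations -/

/-- The anisotropic dilation `dil λ (P, Q) = (λ P, λ^{1/k} Q)`. [cite: HairerMattingly2009, Def 3.4] -/
def dil (k lam : ℝ) (z : ℝ × ℝ) : ℝ × ℝ := (lam * z.1, lam ^ (1 / k) * z.2)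

/-- First component of `dil`. [folklore] -/
@[simp] theorem dil_fst (k lam : ℝ) (z : ℝ × ℝ) : (dil k lam z).1 = lam * z.1 := rfl
/-- Second component of `dil`. [folklore] -/
@[simp] theorem dil_snd (k lam : ℝ) (z : ℝ × ℝ) : (dil k lam z).2 = lam ^ (1 / k) * z.2 := rfl

/-- `dil 1 = id`. [folklore] -/
theorem dil_one (k : ℝ) (z : ℝ × ℝ) : dil k 1 z = z := by
  simp [dil]

/-- `dil (ab) = dil a ∘ dil b` (`a, b ≥ 0`). [folklore] -/
theorem dil_mul {a b : ℝ} (ha : 0 ≤ a) (hb : 0 ≤ b) (z : ℝ × ℝ) :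
    dil k (a * b) z = dil k a (dil k b z) := by
  simp only [dil, Real.mul_rpow ha hb, Prod.mk.injEq]
  constructor <;> ring

/-- `dil λ 0 = 0`. [folklore] -/
theorem dil_zero_right (k lam : ℝ) : dil k lam 0 = 0 := by simp [dil]

/-- `dil λ z = 0 ↔ z = 0` (`λ > 0`). [folklore] -/
theorem dil_eq_zero_iff {lam : ℝ} (hlam : 0 < lam) {z : ℝ × ℝ} : dil k lam z = 0 ↔ z = 0 := by
  refine ⟨fun h => ?_, fun h => h ▸ dil_zero_right k lam⟩
  have h1 : lam * z.1 = 0 := congrArg Prod.fst h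
  have h2 : lam ^ (1 / k) * z.2 = 0 := congrArg Prod.snd h
  have hl : lam ^ (1 / k) ≠ 0 := (Real.rpow_pos_of_pos hlam _).ne'
  exact Prod.ext ((mul_eq_zero.1 h1).resolve_left hlam.ne') ((mul_eq_zero.1 h2).resolve_left hl)

/-- `dil λ z ≠ 0` for `z ≠ 0`, `λ > 0`. [folklore] -/
theorem dil_ne_zero {lam : ℝ} (hlam : 0 < lam) {z : ℝ × ℝ} (hz : z ≠ 0) : dil k lam z ≠ 0 :=
  fun h => hz ((dil_eq_zero_iff hlam).1 h)

/-- `|λ^{1/k} Q|^{2k} = λ² |Q|^{2k}` (`λ > 0`, `k ≠ 0`). [folklore] -/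
theorem abs_rpow_dil_snd (hk : k ≠ 0) {lam : ℝ} (hlam : 0 < lam) (Q : ℝ) :
    |lam ^ (1 / k) * Q| ^ (2 * k) = lam ^ 2 * |Q| ^ (2 * k) := by
  rw [abs_mul, abs_of_pos (Real.rpow_pos_of_pos hlam _),
    Real.mul_rpow (Real.rpow_nonneg hlam.le _) (abs_nonneg _), ← Real.rpow_mul hlam.le,
    show 1 / k * (2 * k) = ((2 : ℕ) : ℝ) by field_simp; norm_num, Real.rpow_natCast]

/-- **`Ĥ ∘ dil λ = λ² Ĥ`.** [cite: HairerMattingly2009, §3.1] -/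
theorem hHat_dil (hk : k ≠ 0) {lam : ℝ} (hlam : 0 < lam) (z : ℝ × ℝ) :
    hHat k (dil k lam z) = lam ^ 2 * hHat k z := by
  simp only [hHat, dil_fst, dil_snd, abs_rpow_dil_snd hk hlam]
  ring

/-- The dilation as a continuous linear map. [folklore] -/
def dilCLM (k lam : ℝ) : ℝ × ℝ →L[ℝ] ℝ × ℝ :=
  (lam • ContinuousLinearMap.fst ℝ ℝ ℝ).prod (lam ^ (1 / k) • ContinuousLinearMap.snd ℝ ℝ ℝ)

/-- `dilCLM` is `dil`. [folklore] -/
@[simp] theorem dilCLM_apply (k lam : ℝ) (z : ℝ × ℝ) : dilCLM k lam z = dil k lam z := by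
  simp [dilCLM, dil]

/-- `dilCLM` is `dil` (coercion). [folklore] -/
theorem coe_dilCLM (k lam : ℝ) : ⇑(dilCLM k lam) = dil k lam := funext (dilCLM_apply k lam)

/-- `dil λ` is continuous. [folklore] -/
theorem continuous_dil (k lam : ℝ) : Continuous (dil k lam) := by
  rw [← coe_dilCLM]; exact (dilCLM k lam).continuous

/-- `dil λ` is its own derivative (it is linear). [folklore] -/
theorem hasFDerivAt_dil (k lam : ℝ) (z : ℝ × ℝ) : HasFDerivAt (dil k lam) (dilCLM k lam) z := by
  rw [← coe_dilCLM]; exact (dilCLM k lam).hasFDerivAt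

/-! ### The radial projection onto the unit shell -/

/-- `proj z = dil (Ĥ z)^{-1/2} z`, the point of the unit shell on the dilation orbit of `z ≠ 0`.
[cite: HairerMattingly2009, §3.1] -/
def proj (k : ℝ) (z : ℝ × ℝ) : ℝ × ℝ := dil k (hHat k z ^ (-(1 / 2 : ℝ))) z

/-- `proj z` lies on the unit shell (`z ≠ 0`). [folklore] -/
theorem hHat_proj (hk : 0 < k) {z : ℝ × ℝ} (hz : z ≠ 0) : hHat k (proj k z) = 1 := by
  have hH := hHat_pos hk hz
  rw [proj, hHat_dil hk.ne' (Real.rpow_pos_of_pos hH _), ← Real.rpow_natCast,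
    ← Real.rpow_mul hH.le]
  norm_num
  rw [Real.rpow_neg_one, inv_mul_cancel₀ hH.ne']

/-- `proj z ∈ unitShell` (`z ≠ 0`). [folklore] -/
theorem proj_mem_unitShell (hk : 0 < k) {z : ℝ × ℝ} (hz : z ≠ 0) : proj k z ∈ unitShell k :=
  hHat_proj hk hz

/-- `proj z ≠ 0` (`z ≠ 0`). [folklore] -/
theorem proj_ne_zero (hk : 0 < k) {z : ℝ × ℝ} (hz : z ≠ 0) : proj k z ≠ 0 :=
  ne_zero_of_mem_unitShell hk (proj_mem_unitShell hk hz)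

/-- `z = dil (Ĥ z)^{1/2} (proj z)`. [folklore] -/
theorem dil_proj (hk : 0 < k) {z : ℝ × ℝ} (hz : z ≠ 0) :
    dil k (hHat k z ^ (1 / 2 : ℝ)) (proj k z) = z := by
  have hH := hHat_pos hk hz
  rw [proj, ← dil_mul (Real.rpow_nonneg hH.le _) (Real.rpow_nonneg hH.le _),
    ← Real.rpow_add hH]
  norm_num
  exact dil_one k z

/-- `proj` is invariant under dilations. [folklore] -/
theorem proj_dil (hk : 0 < k) {lam : ℝ} (hlam : 0 < lam) {z : ℝ × ℝ} (hz : z ≠ 0) :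
    proj k (dil k lam z) = proj k z := by
  have hH := hHat_pos hk hz
  rw [proj, hHat_dil hk.ne' hlam, ← dil_mul (Real.rpow_nonneg (by positivity) _) hlam.le, proj]
  congr 1
  rw [Real.mul_rpow (sq_nonneg _) hH.le, ← Real.rpow_natCast, ← Real.rpow_mul hlam.le]
  norm_num
  rw [mul_comm, ← mul_assoc, Real.rpow_neg_one, mul_inv_cancel₀ hlam.ne', one_mul]

/-- `proj` fixes the unit shell. [folklore] -/
theorem proj_eq_self_of_mem {z : ℝ × ℝ} (hz : z ∈ unitShell k) : proj k z = z := by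
  rw [proj, mem_unitShell.1 hz, Real.one_rpow, dil_one]

/-- `proj` is continuous off the origin. [folklore] -/
theorem continuousOn_proj (hk : 0 < k) : ContinuousOn (proj k) {0}ᶜ := by
  intro z hz
  have hH := hHat_pos hk hz
  unfold proj dil
  refine ContinuousAt.continuousWithinAt ?_
  have h1 : ContinuousAt (fun z => hHat k z ^ (-(1 / 2 : ℝ))) z :=
    ((continuous_hHat hk).continuousAt).rpow_const (Or.inl hH.ne')
  have h2 : ContinuousAt (fun z => (hHat k z ^ (-(1 / 2 : ℝ))) ^ (1 / k)) z :=
    h1.rpow_const (Or.inl (Real.rpow_pos_of_pos hH _).ne')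
  exact (h1.mul continuousAt_fst).prodMk (h2.mul continuousAt_snd)

/-! ### Functions that scale like `Ĥ^α` -/

/-- [HM09, Def. 3.4]: `ψ` **scales like `Ĥ^α`** if `ψ(λP, λ^{1/k}Q) = λ^{2α} ψ(P,Q)` for all
`λ > 0` and `(P,Q) ≠ 0`. [cite: HairerMattingly2009, Def 3.4] -/
def ScalesLike (k α : ℝ) (ψ : ℝ × ℝ → ℝ) : Prop :=
  ∀ ⦃lam : ℝ⦄, 0 < lam → ∀ ⦃z : ℝ × ℝ⦄, z ≠ 0 → ψ (dil k lam z) = lam ^ (2 * α) * ψ z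

namespace ScalesLike

variable {α β : ℝ} {ψ ψ₁ ψ₂ : ℝ × ℝ → ℝ}

/-- A function scaling like `Ĥ^α` is `Ĥ^α` times its restriction to the unit shell. [cite: HairerMattingly2009, §3.1] -/
theorem apply_eq (hk : 0 < k) (h : ScalesLike k α ψ) {z : ℝ × ℝ} (hz : z ≠ 0) :
    ψ z = hHat k z ^ α * ψ (proj k z) := by
  have hH := hHat_pos hk hz
  conv_lhs => rw [← dil_proj hk hz]
  rw [h (Real.rpow_pos_of_pos hH _) (proj_ne_zero hk hz), ← Real.rpow_mul hH.le]
  congr 2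
  ring

/-- Sums of functions scaling like `Ĥ^α` scale like `Ĥ^α`. [folklore] -/
theorem add (h₁ : ScalesLike k α ψ₁) (h₂ : ScalesLike k α ψ₂) : ScalesLike k α (ψ₁ + ψ₂) :=
  fun lam hlam z hz => by simp only [Pi.add_apply, h₁ hlam hz, h₂ hlam hz]; ring

/-- Differences of functions scaling like `Ĥ^α` scale like `Ĥ^α`. [folklore] -/
theorem sub (h₁ : ScalesLike k α ψ₁) (h₂ : ScalesLike k α ψ₂) : ScalesLike k α (ψ₁ - ψ₂) :=
  fun lam hlam z hz => by simp only [Pi.sub_apply, h₁ hlam hz, h₂ hlam hz]; ring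

/-- Negatives of functions scaling like `Ĥ^α` scale like `Ĥ^α`. [folklore] -/
theorem neg (h : ScalesLike k α ψ) : ScalesLike k α (-ψ) :=
  fun lam hlam z hz => by simp only [Pi.neg_apply, h hlam hz]; ring

/-- Constant multiples of functions scaling like `Ĥ^α` scale like `Ĥ^α`. [folklore] -/
theorem const_mul (h : ScalesLike k α ψ) (c : ℝ) : ScalesLike k α (fun z => c * ψ z) :=
  fun lam hlam z hz => by simp only [h hlam hz]; ring

/-- Products: `Ĥ^α · Ĥ^β`-scaling functions scale like `Ĥ^{α+β}`. [folklore] -/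
theorem mul (h₁ : ScalesLike k α ψ₁) (h₂ : ScalesLike k β ψ₂) : ScalesLike k (α + β) (ψ₁ * ψ₂) :=
  fun lam hlam z hz => by
    simp only [Pi.mul_apply, h₁ hlam hz, h₂ hlam hz, mul_add, Real.rpow_add hlam]; ring

/-- Powers: `ψ^n` scales like `Ĥ^{nα}`. [folklore] -/
theorem pow (h : ScalesLike k α ψ) (n : ℕ) : ScalesLike k (n * α) (fun z => ψ z ^ n) :=
  fun lam hlam z hz => by
    simp only [h hlam hz, mul_pow, ← Real.rpow_natCast, ← Real.rpow_mul hlam.le]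
    congr 2; ring

/-- `|ψ| ≤ C Ĥ^α` for a function that scales like `Ĥ^α` and is continuous on the unit shell.
[cite: HairerMattingly2009, §3.1] -/
theorem exists_abs_le (hk : 0 < k) (h : ScalesLike k α ψ) (hc : ContinuousOn ψ (unitShell k)) :
    ∃ C : ℝ, 0 ≤ C ∧ ∀ z : ℝ × ℝ, z ≠ 0 → |ψ z| ≤ C * hHat k z ^ α := by
  obtain ⟨C, hC⟩ := (isCompact_unitShell hk).exists_bound_of_continuousOn hc
  refine ⟨max C 0, le_max_right _ _, fun z hz => ?_⟩
  rw [h.apply_eq hk hz, abs_mul, abs_of_nonneg (Real.rpow_nonneg (hHat_nonneg hk z) _), mul_comm]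
  exact mul_le_mul_of_nonneg_right ((hC _ (proj_mem_unitShell hk hz)).trans (le_max_left _ _))
    (Real.rpow_nonneg (hHat_nonneg hk z) _)

end ScalesLike

/-- `Ĥ` scales like `Ĥ^1`. [folklore] -/
theorem scalesLike_hHat (hk : 0 < k) : ScalesLike k 1 (hHat k) := fun lam hlam z _ => by
  rw [hHat_dil hk.ne' hlam, show (2 : ℝ) * 1 = ((2 : ℕ) : ℝ) by norm_num, Real.rpow_natCast]

/-- `Ĥ^s` scales like `Ĥ^s`. [folklore] -/
theorem scalesLike_hHat_rpow (hk : 0 < k) (s : ℝ) : ScalesLike k s fun z => hHat k z ^ s :=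
  fun lam hlam z hz => by
    dsimp only
    rw [hHat_dil hk.ne' hlam, Real.mul_rpow (sq_nonneg _) (hHat_nonneg hk z), ← Real.rpow_natCast,
      ← Real.rpow_mul hlam.le]
    norm_num

/-- `P` scales like `Ĥ^{1/2}`. [folklore] -/
theorem scalesLike_fst (k : ℝ) : ScalesLike k (1 / 2) fun z : ℝ × ℝ => z.1 := fun lam hlam z _ => by
  dsimp only
  rw [dil_fst, show 2 * (1 / 2 : ℝ) = 1 by norm_num, Real.rpow_one]

/-- `Q` scales like `Ĥ^{1/(2k)}`. [folklore] -/
theorem scalesLike_snd (k : ℝ) : ScalesLike k (1 / (2 * k)) fun z : ℝ × ℝ => z.2 :=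
  fun lam hlam z _ => by
    dsimp only
    rw [dil_snd]
    congr 2
    field_simp

/-- Constants scale like `Ĥ^0`. [folklore] -/
theorem scalesLike_const_iff_zero : ScalesLike k 0 fun _ : ℝ × ℝ => (1 : ℝ) := fun lam hlam z _ => by
  simp

/-! ### The Hamiltonian vector field `Y = (-|Q|^{2k-2}Q, P)` and the Liouville operator `X_Ĥ` -/

/-- `V'(Q) = |Q|^{2k-2} Q`, the derivative of `|Q|^{2k}/(2k)`. [cite: HairerMattingly2009, §3.1] -/
def dV (k : ℝ) (Q : ℝ) : ℝ := |Q| ^ (2 * k - 2) * Q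

/-- The Hamiltonian vector field of `Ĥ`: `Y(P,Q) = (-|Q|^{2k-2}Q, P)` (`Ṗ = -V'(Q)`, `Q̇ = P`).
[cite: HairerMattingly2009, §2 (e:simple)] -/
def field (k : ℝ) (z : ℝ × ℝ) : ℝ × ℝ := (-dV k z.2, z.1)

/-- First component of the Hamiltonian field. [folklore] -/
@[simp] theorem field_fst (k : ℝ) (z : ℝ × ℝ) : (field k z).1 = -dV k z.2 := rfl
/-- Second component of the Hamiltonian field. [folklore] -/
@[simp] theorem field_snd (k : ℝ) (z : ℝ × ℝ) : (field k z).2 = z.1 := rfl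

/-- The Liouville operator `X_Ĥ ψ = P ∂_Q ψ - |Q|^{2k-2}Q ∂_P ψ = Dψ · Y`.
[cite: HairerMattingly2009, §3.1] -/
def liouville (k : ℝ) (ψ : ℝ × ℝ → ℝ) (z : ℝ × ℝ) : ℝ := fderiv ℝ ψ z (field k z)

/-- `V'(0) = 0`. [folklore] -/
theorem dV_zero (k : ℝ) : dV k 0 = 0 := by simp [dV]

/-- `|V'(Q)| = |Q|^{2k-1}`. [folklore] -/
theorem abs_dV (hk : 1 < 2 * k) (Q : ℝ) : |dV k Q| = |Q| ^ (2 * k - 1) := by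
  rw [dV, abs_mul, abs_of_nonneg (Real.rpow_nonneg (abs_nonneg Q) _),
    show 2 * k - 1 = (2 * k - 2) + 1 by ring, Real.rpow_add_one' (abs_nonneg Q) (by linarith)]

/-- `Q V'(Q) = |Q|^{2k}`. [folklore] -/
theorem mul_dV (hk : 1 < 2 * k) (Q : ℝ) : Q * dV k Q = |Q| ^ (2 * k) := by
  rw [dV, mul_comm, mul_assoc, ← sq, ← sq_abs, ← Real.rpow_natCast,
    ← Real.rpow_add' (abs_nonneg Q) (by norm_num; linarith)]
  norm_num

/-- `V'` is odd. [folklore] -/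
theorem dV_neg (k Q : ℝ) : dV k (-Q) = -dV k Q := by simp [dV, abs_neg]

/-- Scaling of `V'`: `V'(λ^{1/k}Q) = λ^{2-1/k} V'(Q)`. [folklore] -/
theorem dV_dil (hk : 1 < 2 * k) {lam : ℝ} (hlam : 0 < lam) (Q : ℝ) :
    dV k (lam ^ (1 / k) * Q) = lam ^ (2 - 1 / k) * dV k Q := by
  have hk0 : k ≠ 0 := by rintro rfl; norm_num at hk
  rw [dV, dV, abs_mul, abs_of_pos (Real.rpow_pos_of_pos hlam _),
    Real.mul_rpow (Real.rpow_nonneg hlam.le _) (abs_nonneg _), ← Real.rpow_mul hlam.le]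
  have : lam ^ (2 - 1 / k) = lam ^ (1 / k * (2 * k - 2)) * lam ^ (1 / k) := by
    rw [← Real.rpow_add hlam]; congr 1; field_simp; ring
  rw [this]; ring

/-- **Scaling of the Hamiltonian field**: `Y(dil λ z) = λ^{1-1/k} dil λ (Y z)`. [folklore] -/
theorem field_dil (hk : 1 < 2 * k) {lam : ℝ} (hlam : 0 < lam) (z : ℝ × ℝ) :
    field k (dil k lam z) = lam ^ (1 - 1 / k) • dil k lam (field k z) := by
  ext
  · simp only [field_fst, dil_snd, dV_dil hk hlam, Prod.smul_fst, dil_fst, smul_eq_mul]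
    have : lam ^ (2 - 1 / k) = lam ^ (1 - 1 / k) * lam := by
      rw [← Real.rpow_add_one hlam.ne']; congr 1; ring
    rw [this]; ring
  · simp only [field_snd, dil_fst, Prod.smul_snd, dil_snd, smul_eq_mul]
    rw [← mul_assoc, ← Real.rpow_add hlam]
    congr 1
    rw [show 1 - 1 / k + 1 / k = (1 : ℝ) by ring, Real.rpow_one]

/-! ### Regularity -/

/-- `d/dQ (|Q|^{2k}/(2k)) = |Q|^{2k-2} Q`. [folklore] -/
theorem hasDerivAt_abs_rpow_div (hk : 1 < 2 * k) (Q : ℝ) :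
    HasDerivAt (fun Q : ℝ => |Q| ^ (2 * k) / (2 * k)) (dV k Q) Q := by
  have hk0 : k ≠ 0 := by rintro rfl; norm_num at hk
  have h := (hasDerivAt_abs_rpow Q hk).div_const (2 * k)
  refine h.congr_deriv ?_
  rw [dV]
  field_simp

/-- `d/dQ (|Q|^{2k-2} Q) = (2k-1)|Q|^{2k-2}` (`2k - 2 > 1`). [folklore] -/
theorem hasDerivAt_dV (hk : 3 / 2 < k) (Q : ℝ) :
    HasDerivAt (dV k) ((2 * k - 1) * |Q| ^ (2 * k - 2)) Q := by
  have h1 : HasDerivAt (fun Q : ℝ => |Q| ^ (2 * k - 2)) ((2 * k - 2) * |Q| ^ (2 * k - 2 - 2) * Q) Q :=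
    hasDerivAt_abs_rpow Q (by linarith)
  have h := h1.mul (hasDerivAt_id Q)
  refine h.congr_deriv ?_
  simp only [id]
  rcases eq_or_ne Q 0 with hQ | hQ
  · subst hQ
    simp [Real.zero_rpow (show (2 * k - 2 : ℝ) ≠ 0 by linarith)]
  · have hQ' : 0 < |Q| := abs_pos.2 hQ
    have : |Q| ^ (2 * k - 2 - 2) * Q * Q = |Q| ^ (2 * k - 2) := by
      rw [mul_assoc, ← sq, ← sq_abs, ← Real.rpow_natCast, ← Real.rpow_add hQ']
      norm_num
    calc (2 * k - 2) * |Q| ^ (2 * k - 2 - 2) * Q * Q + |Q| ^ (2 * k - 2) * 1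
        = (2 * k - 2) * (|Q| ^ (2 * k - 2 - 2) * Q * Q) + |Q| ^ (2 * k - 2) := by ring
      _ = (2 * k - 1) * |Q| ^ (2 * k - 2) := by rw [this]; ring

/-- `deriv V' = (2k-1)|Q|^{2k-2}`. [folklore] -/
theorem deriv_dV (hk : 3 / 2 < k) : deriv (dV k) = fun Q => (2 * k - 1) * |Q| ^ (2 * k - 2) :=
  funext fun Q => (hasDerivAt_dV hk Q).deriv

/-- `V' = |Q|^{2k-2}Q` is `C²` for `k > 3/2`. [cite: HairerMattingly2009, §3.1] -/
theorem contDiff_dV (hk : 3 / 2 < k) : ContDiff ℝ 2 (dV k) := by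
  rw [show (2 : WithTop ℕ∞) = 1 + 1 by norm_num, contDiff_succ_iff_deriv]
  refine ⟨fun Q => (hasDerivAt_dV hk Q).differentiableAt, fun h => absurd h (by simp), ?_⟩
  rw [deriv_dV hk]
  have h1 : ContDiff ℝ 1 (fun Q : ℝ => ‖Q‖ ^ (2 * k - 2)) := contDiff_norm_rpow (by linarith)
  simp only [Real.norm_eq_abs] at h1
  exact contDiff_const.mul h1

/-- `|Q|^{2k}/(2k)` is `C²` for `k > 3/2` (indeed `C³`). [cite: HairerMattingly2009, §3.1] -/
theorem contDiff_abs_rpow_div (hk : 3 / 2 < k) : ContDiff ℝ 2 fun Q : ℝ => |Q| ^ (2 * k) / (2 * k) := by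
  have hk1 : 1 < 2 * k := by linarith
  rw [show (2 : WithTop ℕ∞) = 1 + 1 by norm_num, contDiff_succ_iff_deriv]
  refine ⟨fun Q => (hasDerivAt_abs_rpow_div hk1 Q).differentiableAt, fun h => absurd h (by simp), ?_⟩
  have : deriv (fun Q : ℝ => |Q| ^ (2 * k) / (2 * k)) = dV k :=
    funext fun Q => (hasDerivAt_abs_rpow_div hk1 Q).deriv
  rw [this]
  exact (contDiff_dV hk).of_le (by norm_num)

/-- `Ĥ` is `C²` for `k > 3/2`. [cite: HairerMattingly2009, §3.1] -/
theorem contDiff_hHat (hk : 3 / 2 < k) : ContDiff ℝ 2 (hHat k) := by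
  unfold hHat
  exact ((contDiff_fst.pow 2).div_const 2).add ((contDiff_abs_rpow_div hk).comp contDiff_snd)

/-- The Hamiltonian field is `C²` for `k > 3/2`. [cite: HairerMattingly2009, §3.1] -/
theorem contDiff_field (hk : 3 / 2 < k) : ContDiff ℝ 2 (field k) := by
  unfold field
  exact ((contDiff_dV hk).comp contDiff_snd).neg.prodMk contDiff_fst

/-- `V'` is continuous (`k ≥ 1`). [folklore] -/
theorem continuous_dV (hk : 1 ≤ k) : Continuous (dV k) := by
  unfold dV
  exact (continuous_abs.rpow_const fun _ => Or.inr (by linarith)).mul continuous_id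

/-- The Hamiltonian field is continuous (`k ≥ 1`). [folklore] -/
theorem continuous_field (hk : 1 ≤ k) : Continuous (field k) := by
  unfold field
  exact ((continuous_dV hk).comp continuous_snd).neg.prodMk continuous_fst

/-- The derivative of `Ĥ`: `DĤ(P,Q)(v) = P v₁ + V'(Q) v₂`. [folklore] -/
theorem hasFDerivAt_hHat (hk : 1 < 2 * k) (z : ℝ × ℝ) :
    HasFDerivAt (hHat k)
      (z.1 • ContinuousLinearMap.fst ℝ ℝ ℝ + dV k z.2 • ContinuousLinearMap.snd ℝ ℝ ℝ) z := by
  have h1 : HasFDerivAt (fun z : ℝ × ℝ => z.1 ^ 2 / 2) (z.1 • ContinuousLinearMap.fst ℝ ℝ ℝ) z := by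
    have h : HasDerivAt (fun P : ℝ => P ^ 2 / 2) z.1 z.1 := by
      simpa using ((hasDerivAt_pow 2 z.1).div_const 2)
    refine (h.hasFDerivAt.comp z hasFDerivAt_fst).congr_fderiv ?_
    ext <;> simp [mul_comm]
  have h2 : HasFDerivAt (fun z : ℝ × ℝ => |z.2| ^ (2 * k) / (2 * k))
      (dV k z.2 • ContinuousLinearMap.snd ℝ ℝ ℝ) z := by
    refine ((hasDerivAt_abs_rpow_div hk z.2).hasFDerivAt.comp z hasFDerivAt_snd).congr_fderiv ?_
    ext <;> simp [mul_comm]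
  exact h1.add h2

/-- `DĤ(z)(v) = P v₁ + V'(Q) v₂`. [folklore] -/
theorem fderiv_hHat_apply (hk : 1 < 2 * k) (z v : ℝ × ℝ) :
    fderiv ℝ (hHat k) z v = z.1 * v.1 + dV k z.2 * v.2 := by
  rw [(hasFDerivAt_hHat hk z).fderiv]
  simp

/-- `Ĥ` is differentiable (`2k > 1`). [folklore] -/
theorem differentiable_hHat (hk : 1 < 2 * k) : Differentiable ℝ (hHat k) :=
  fun z => (hasFDerivAt_hHat hk z).differentiableAt

/-- **Conservation of energy**: `DĤ · Y = 0`. [cite: HairerMattingly2009, §2] -/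
theorem fderiv_hHat_field (hk : 1 < 2 * k) (z : ℝ × ℝ) : fderiv ℝ (hHat k) z (field k z) = 0 := by
  rw [fderiv_hHat_apply hk, field_fst, field_snd]
  ring

/-- `X_Ĥ Ĥ = 0`. [folklore] -/
theorem liouville_hHat (hk : 1 < 2 * k) (z : ℝ × ℝ) : liouville k (hHat k) z = 0 :=
  fderiv_hHat_field hk z

/-- `proj` is `C²` away from the origin (`k > 3/2`). [folklore] -/
theorem contDiffOn_proj (hk : 3 / 2 < k) : ContDiffOn ℝ 2 (proj k) {0}ᶜ := by
  have hk0 : 0 < k := by linarith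
  intro z hz
  have hH := hHat_pos hk0 hz
  have h1 : ContDiffAt ℝ 2 (fun z => hHat k z ^ (-(1 / 2 : ℝ))) z :=
    (contDiff_hHat hk).contDiffAt.rpow_const_of_ne hH.ne'
  have h2 : ContDiffAt ℝ 2 (fun z => (hHat k z ^ (-(1 / 2 : ℝ))) ^ (1 / k)) z :=
    h1.rpow_const_of_ne (Real.rpow_pos_of_pos hH _).ne'
  exact ((h1.mul contDiffAt_fst).prodMk (h2.mul contDiffAt_snd)).contDiffWithinAt

/-! ### [HM09, Lemma 3.5]: scaling of derivatives -/

namespace ScalesLike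

variable {α : ℝ} {ψ : ℝ × ℝ → ℝ}

/-- If `ψ` scales like `Ĥ^α` and is differentiable off the origin then
`Dψ(dil λ z)(dil λ v) = λ^{2α} Dψ(z)(v)`. [cite: HairerMattingly2009, Lemma 3.5] -/
theorem fderiv_dil_apply (h : ScalesLike k α ψ) (hd : ∀ z : ℝ × ℝ, z ≠ 0 → DifferentiableAt ℝ ψ z)
    {lam : ℝ} (hlam : 0 < lam) {z : ℝ × ℝ} (hz : z ≠ 0) (v : ℝ × ℝ) :
    fderiv ℝ ψ (dil k lam z) (dil k lam v) = lam ^ (2 * α) * fderiv ℝ ψ z v := by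
  have hev : (fun w => ψ (dil k lam w)) =ᶠ[𝓝 z] fun w => lam ^ (2 * α) * ψ w := by
    filter_upwards [isOpen_compl_singleton.mem_nhds hz] with w hw
    exact h hlam hw
  have hcomp : HasFDerivAt (fun w => ψ (dil k lam w)) ((fderiv ℝ ψ (dil k lam z)).comp (dilCLM k lam)) z :=
    (hd _ (dil_ne_zero hlam hz)).hasFDerivAt.comp z (hasFDerivAt_dil k lam z)
  have hsmul : HasFDerivAt (fun w => lam ^ (2 * α) * ψ w) (lam ^ (2 * α) • fderiv ℝ ψ z) z :=
    (hd z hz).hasFDerivAt.const_mul (lam ^ (2 * α))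
  have heq := hev.fderiv_eq (𝕜 := ℝ)
  rw [hcomp.fderiv, hsmul.fderiv] at heq
  have := congrArg (fun L : ℝ × ℝ →L[ℝ] ℝ => L v) heq
  simpa using this

/-- [HM09, Lemma 3.5]: `∂_P ψ` scales like `Ĥ^{α - 1/2}`. [cite: HairerMattingly2009, Lemma 3.5] -/
theorem fderiv_fst (h : ScalesLike k α ψ) (hd : ∀ z : ℝ × ℝ, z ≠ 0 → DifferentiableAt ℝ ψ z) :
    ScalesLike k (α - 1 / 2) fun z => fderiv ℝ ψ z (1, 0) := by
  intro lam hlam z hz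
  dsimp only
  have h1 := h.fderiv_dil_apply hd hlam hz (1, 0)
  have hdil : dil k lam (1, 0) = lam • ((1 : ℝ), (0 : ℝ)) := by simp [dil]
  rw [hdil, map_smul, smul_eq_mul] at h1
  have : lam ^ (2 * (α - 1 / 2)) = lam⁻¹ * lam ^ (2 * α) := by
    rw [show 2 * (α - 1 / 2) = 2 * α + (-1) by ring, Real.rpow_add hlam, Real.rpow_neg_one]; ring
  rw [this, mul_assoc, ← h1, ← mul_assoc, inv_mul_cancel₀ hlam.ne', one_mul]

/-- [HM09, Lemma 3.5]: `∂_Q ψ` scales like `Ĥ^{α - 1/(2k)}`. [cite: HairerMattingly2009, Lemma 3.5] -/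
theorem fderiv_snd (h : ScalesLike k α ψ) (hd : ∀ z : ℝ × ℝ, z ≠ 0 → DifferentiableAt ℝ ψ z) :
    ScalesLike k (α - 1 / (2 * k)) fun z => fderiv ℝ ψ z (0, 1) := by
  intro lam hlam z hz
  dsimp only
  have h1 := h.fderiv_dil_apply hd hlam hz (0, 1)
  have hdil : dil k lam (0, 1) = lam ^ (1 / k) • ((0 : ℝ), (1 : ℝ)) := by simp [dil]
  rw [hdil, map_smul, smul_eq_mul] at h1
  have hl : lam ^ (1 / k) ≠ 0 := (Real.rpow_pos_of_pos hlam _).ne'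
  have : lam ^ (2 * (α - 1 / (2 * k))) = (lam ^ (1 / k))⁻¹ * lam ^ (2 * α) := by
    rw [← Real.rpow_neg hlam.le, ← Real.rpow_add hlam]; congr 1; ring
  rw [this, mul_assoc, ← h1, ← mul_assoc, inv_mul_cancel₀ hl, one_mul]

/-- [HM09, Lemma 3.5]: `X_Ĥ ψ` scales like `Ĥ^{α + 1/2 - 1/(2k)}`. [cite: HairerMattingly2009, Lemma 3.5] -/
theorem liouville (hk : 1 < 2 * k) (h : ScalesLike k α ψ)
    (hd : ∀ z : ℝ × ℝ, z ≠ 0 → DifferentiableAt ℝ ψ z) :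
    ScalesLike k (α + 1 / 2 - 1 / (2 * k)) (liouville k ψ) := by
  intro lam hlam z hz
  rw [FreeOscillator.liouville, FreeOscillator.liouville, field_dil hk hlam, map_smul, smul_eq_mul,
    h.fderiv_dil_apply hd hlam hz, ← mul_assoc, ← Real.rpow_add hlam]
  congr 2; ring

end ScalesLike

/-- `Y` is odd and `dil` is linear, so `dil` commutes with negation. [folklore] -/
theorem dil_neg (k lam : ℝ) (z : ℝ × ℝ) : dil k lam (-z) = -dil k lam z := by
  simp [dil]

/-- The Hamiltonian field is odd. [folklore] -/
theorem field_neg (k : ℝ) (z : ℝ × ℝ) : field k (-z) = -field k z := by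
  ext <;> simp [field, dV_neg]

/-- `Ĥ` is even. [folklore] -/
theorem hHat_neg (k : ℝ) (z : ℝ × ℝ) : hHat k (-z) = hHat k z := by
  simp [hHat, abs_neg]

/-- `proj` is odd. [folklore] -/
theorem proj_neg (k : ℝ) (z : ℝ × ℝ) : proj k (-z) = -proj k z := by
  rw [proj, proj, hHat_neg, dil_neg]

end Literature.MathematicalPhysics.KineticTheory.FreeOscillator

end
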